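import Mathlib
import Literature.Analysis.FluidPDE.ClassicalSolution
import Literature.Analysis.FluidPDE.VorticityCalculus
import Summits.NavierStokesRegularity.NavierStokesRegularity.Theorems.ThreadingFluxHorizonTowerDefs
import Summits.NavierStokesRegularity.NavierStokesRegularity.Theorems.ThreadingFluxHorizonTowerSecondJetHeadForm
import Summits.NavierStokesRegularity.NavierStokesRegularity.Theorems.ThreadingFluxHorizonTowerOrderOneSphereEuler
import Summits.NavierStokesRegularity.NavierStokesRegularity.Theorems.ThreadingFluxHorizonTowerPoloidalFieldCalculus
import HarnessLib

/-!
# Crux `PoloidalLiouville` (stmt-NavierStokesRegularity-1222, W1), crux idea «horizon-threading-tower» (ns-idea-15):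
# tools for the blow-down form of the order-two horizon law (layer (D) of the `OrderTwoHorizonLawBlowdownReg` chain)

Four small facts used by `Theorems/ThreadingFluxHorizonOrderTwoLawBlowdown.lean`:

* `OrderTwoBlowdown.exists_contDiff_eventuallyEq` — a function that is `C^n` off the origin agrees, near any `z ≠ 0`, with a
  globally `C^n` function (smooth cut-off; this lets the global-`ContDiff` jet calculus of `JetConv`/`Scaling` act on blow-down
  limits, which are only regular on `ℝ³ ∖ 0`);
* `OrderTwoBlowdown.horizonL2_congr` — `horizonL2 U 0 z` depends only on the germ of `U` at `z`;
* `OrderTwoBlowdown.radialVirial_head_eventuallyEq_const` — for degree-0 homogeneous `U`, `P₀` (differentiable off `0`) the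
  radial virial of the limit head `P₀ + s₀ log r + |U|²/2` is the CONSTANT `s₀` off the origin (Euler identities
  `y·∇P₀ = 0`, `y·∇|U|² = 0`, `y·∇ log r = 1`), stated for germ representatives `V`, `Q`.  This is the step where the
  pressure drops out of the order-two horizon law;
* `OrderTwoBlowdown.loc2_eq_headTerm_of_unthreaded` — on an unthreaded open window `∂ₜ²F = 0`, so the landed
  `HorizonTower.secondJetHeadForm` reads `Loc₂[u t₀] = ⟪curl (u t₀), ∇(r∂ᵣB)⟫` pointwise.

Helper lemmas only; no Prop of the sketch is restated here; NS regularity is NOT proved by any of this.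
-/

-- the summit and its single problem share the name (D-0017 nested layout)
set_option linter.dupNamespace false

noncomputable section

namespace Summit.NavierStokesRegularity.NavierStokesRegularity.Theorems.PoloidalLiouville.HorizonTower

open Set Function Filter Topology Metric
open scoped Topology RealInnerProductSpace Laplacian ContDiff
open Literature.Analysis.FluidPDE

namespace OrderTwoBlowdown

/-- A `C^n` function off the origin agrees near any `z ≠ 0` with a GLOBALLY `C^n` function (cut-off). -/
theorem exists_contDiff_eventuallyEq {F : Type*} [NormedAddCommGroup F] [NormedSpace ℝ F] {n : ℕ} {U : E3 → F}
    (hU : ContDiffOn ℝ n U {0}ᶜ) {z : E3} (hz : z ≠ 0) :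
    ∃ V : E3 → F, ContDiff ℝ n V ∧ V =ᶠ[𝓝 z] U := by
  have hopen : IsOpen ({0}ᶜ : Set E3) := isOpen_compl_singleton
  have hzpos : 0 < ‖z‖ := norm_pos_iff.mpr hz
  let χ : ContDiffBump z := ⟨‖z‖ / 4, ‖z‖ / 2, by positivity, by linarith⟩
  refine ⟨fun y => χ y • U y, ?_, ?_⟩
  · rw [contDiff_iff_contDiffAt]
    intro y
    by_cases hy : y = 0
    · have hzero : (fun y => χ y • U y) =ᶠ[𝓝 y] fun _ => (0 : F) := by
        subst hy
        have h0 : ‖z‖ / 2 < dist (0 : E3) z := by rw [dist_comm, dist_zero_right]; linarith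
        have hcont : Continuous fun y : E3 => dist y z := continuous_id.dist continuous_const
        filter_upwards [hcont.continuousAt.eventually (Ioi_mem_nhds h0)] with y hy
        show χ y • U y = 0
        rw [χ.zero_of_le_dist (le_of_lt hy), zero_smul]
      exact contDiffAt_const.congr_of_eventuallyEq hzero
    · exact (χ.contDiff (n := n)).contDiffAt.smul ((hU y hy).contDiffAt (hopen.mem_nhds hy))
  · filter_upwards [isOpen_ball.mem_nhds (mem_ball_self (by positivity : (0:ℝ) < ‖z‖ / 4))] with y hy
    show χ y • U y = U y
    rw [χ.one_of_mem_closedBall (ball_subset_closedBall hy), one_smul]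

/-- `horizonL2` depends only on the germ of the profile. -/
theorem horizonL2_congr {U V : E3 → E3} {z : E3} (h : V =ᶠ[𝓝 z] U) : horizonL2 V 0 z = horizonL2 U 0 z := by
  -- germs of the ingredients
  have hnhds : ∀ᶠ y in 𝓝 z, V =ᶠ[𝓝 y] U := eventually_eventuallyEq_nhds.mpr h
  have hcurl : ∀ᶠ y in 𝓝 z, curl V y = curl U y := by
    filter_upwards [hnhds] with y hy
    rw [curl_eq_curlCLM, curl_eq_curlCLM, hy.fderiv_eq]
  have hval : ∀ᶠ y in 𝓝 z, V y = U y := h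
  have hΛ : (fun y => cross (V y) (curl V y)) =ᶠ[𝓝 z] fun y => cross (U y) (curl U y) := by
    filter_upwards [hcurl, hval] with y h1 h2; rw [h1, h2]
  have hΛnhds : ∀ᶠ y in 𝓝 z, (fun w => cross (V w) (curl V w)) =ᶠ[𝓝 y] fun w => cross (U w) (curl U w) :=
    eventually_eventuallyEq_nhds.mpr hΛ
  have hcurlΛ : ∀ᶠ y in 𝓝 z, curl (fun w => cross (V w) (curl V w)) y = curl (fun w => cross (U w) (curl U w)) y := by
    filter_upwards [hΛnhds] with y hy
    rw [curl_eq_curlCLM, curl_eq_curlCLM, hy.fderiv_eq]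
  have hF1 : (fun y => cross (cross (V y) (curl V y)) (curl V y)) =ᶠ[𝓝 z]
      fun y => cross (cross (U y) (curl U y)) (curl U y) := by
    filter_upwards [hcurl, hval] with y h1 h2; rw [h1, h2]
  have hF2 : (fun y => cross (V y) (curl (fun w => cross (V w) (curl V w)) y)) =ᶠ[𝓝 z]
      fun y => cross (U y) (curl (fun w => cross (U w) (curl U w)) y) := by
    filter_upwards [hcurlΛ, hval] with y h1 h2; rw [h1, h2]
  unfold horizonL2
  rw [curl_eq_curlCLM, hF1.fderiv_eq, ← curl_eq_curlCLM]
  rw [curl_eq_curlCLM (fun y => cross (V y) _), hF2.fderiv_eq, ← curl_eq_curlCLM]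


/-- PRESSURE DROP-OUT AT THE HORIZON: if `U` is degree-0 homogeneous and `P₀` is dilation invariant (both differentiable off
the origin), `V` agrees with `U` near `z ≠ 0` and `Q` agrees with `P₀ + s₀ log r` near `z`, then the radial virial
`y·∇(Q + |V|²/2)` of the head is identically `s₀` near `z`. -/
theorem radialVirial_head_eventuallyEq_const {U V : E3 → E3} {P₀ Q : E3 → ℝ} {s₀ : ℝ} {z : E3} (hz : z ≠ 0)
    (hUhom : IsZeroHomogeneousAbout 0 U) (hPhom : ∀ c : ℝ, 0 < c → ∀ y : E3, P₀ (c • y) = P₀ y)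
    (hU : DifferentiableOn ℝ U {0}ᶜ) (hP : DifferentiableOn ℝ P₀ {0}ᶜ)
    (hVU : V =ᶠ[𝓝 z] U) (hQP : Q =ᶠ[𝓝 z] fun y => P₀ y + s₀ * Real.log ‖y‖) :
    radialVirial (head V Q) 0 =ᶠ[𝓝 z] fun _ => s₀ := by
  have hopen : IsOpen ({0}ᶜ : Set E3) := isOpen_compl_singleton
  set Pinf : E3 → ℝ := fun y => P₀ y + s₀ * Real.log ‖y‖ with hPinf
  have hnhdsV : ∀ᶠ y in 𝓝 z, V =ᶠ[𝓝 y] U := eventually_eventuallyEq_nhds.mpr hVU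
  have hnhdsQ : ∀ᶠ y in 𝓝 z, Q =ᶠ[𝓝 y] Pinf := eventually_eventuallyEq_nhds.mpr hQP
  have hne : ∀ᶠ y in 𝓝 z, y ≠ (0 : E3) := eventually_ne_nhds hz
  filter_upwards [hnhdsV, hnhdsQ, hne] with y hVy hQy hy
  have hh : head V Q =ᶠ[𝓝 y] head U Pinf := by
    filter_upwards [hVy, hQy] with y' h1 h2
    simp only [head, h1, h2]
  have hny : ‖y‖ ≠ 0 := norm_ne_zero_iff.mpr hy
  have hUd : DifferentiableAt ℝ U y := (hU y hy).differentiableAt (hopen.mem_nhds hy)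
  have hP0d : DifferentiableAt ℝ P₀ y := (hP y hy).differentiableAt (hopen.mem_nhds hy)
  have hnormd : DifferentiableAt ℝ (fun y : E3 => ‖y‖) y := (contDiffAt_norm ℝ hy (n := 1)).differentiableAt (by simp)
  have hlogd : DifferentiableAt ℝ (fun y : E3 => Real.log ‖y‖) y := hnormd.log hny
  have hslogd : DifferentiableAt ℝ (fun y : E3 => s₀ * Real.log ‖y‖) y := hlogd.const_mul s₀
  have hPinfd : DifferentiableAt ℝ Pinf y := hP0d.add hslogd
  have hsqd : DifferentiableAt ℝ (fun y => ‖U y‖ ^ 2 / 2) y := by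
    have h := (hUd.norm_sq ℝ).mul_const (2⁻¹ : ℝ)
    simpa only [div_eq_mul_inv] using h
  -- Euler identities at `y`
  have hEP : fderiv ℝ P₀ y y = 0 := by
    have hev : ∀ᶠ c in 𝓝 (1 : ℝ), P₀ (c • y) = (fun _ : ℝ => (1 : ℝ)) c • P₀ y := by
      filter_upwards [Ioi_mem_nhds (zero_lt_one' ℝ)] with c hc
      rw [hPhom c hc y, one_smul]
    have h := PoloidalField.fderiv_apply_self_of_homogeneous (a := fun _ : ℝ => (1 : ℝ)) (a' := 0) hP0d
      (hasDerivAt_const (1 : ℝ) (1 : ℝ)) hev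
    rw [h, zero_smul]
  have hEU : fderiv ℝ (fun y => ‖U y‖ ^ 2 / 2) y y = 0 := by
    have hev : ∀ᶠ c in 𝓝 (1 : ℝ), (fun y => ‖U y‖ ^ 2 / 2) (c • y) = (fun _ : ℝ => (1 : ℝ)) c • (fun y => ‖U y‖ ^ 2 / 2) y := by
      filter_upwards [Ioi_mem_nhds (zero_lt_one' ℝ)] with c hc
      have hh := hUhom c hc y
      rw [zero_add, zero_add] at hh
      simp only [hh, one_smul]
    have h := PoloidalField.fderiv_apply_self_of_homogeneous (a := fun _ : ℝ => (1 : ℝ)) (a' := 0) hsqd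
      (hasDerivAt_const (1 : ℝ) (1 : ℝ)) hev
    rw [h, zero_smul]
  have hElog : fderiv ℝ (fun y : E3 => Real.log ‖y‖) y y = 1 := by
    have h' : HasFDerivAt (fun y : E3 => Real.log ‖y‖) ((‖y‖)⁻¹ • fderiv ℝ (fun y : E3 => ‖y‖) y) y :=
      (Real.hasDerivAt_log hny).comp_hasFDerivAt y hnormd.hasFDerivAt
    rw [h'.fderiv, smul_apply, SphereEuler.fderiv_norm_apply hy, real_inner_self_eq_norm_sq, smul_eq_mul]
    field_simp
  -- assemble
  unfold radialVirial
  rw [sub_zero, gradient, hh.fderiv_eq, real_inner_comm, InnerProductSpace.toDual_symm_apply]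
  show fderiv ℝ (fun x => Pinf x + ‖U x‖ ^ 2 / 2) y y = s₀
  rw [fderiv_fun_add hPinfd hsqd, add_apply, hEU, add_zero]
  show fderiv ℝ (fun x => P₀ x + s₀ * Real.log ‖x‖) y y = s₀
  rw [fderiv_fun_add hP0d hslogd, add_apply, hEP, zero_add, fderiv_const_mul hlogd,
    smul_apply, hElog, smul_eq_mul, mul_one]

/-- ORDER-TWO JET ON AN UNTHREADED WINDOW: if the threading flux vanishes identically on an open time window `S ∋ t₀`,
then `∂ₜ²F(t₀,x) = 0`, so `HorizonTower.secondJetHeadForm` reads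
`Loc₂[u t₀](x) = ⟪curl (u t₀) x, ∇(radialVirial (head (u t₀) (p t₀)) x₀) x⟫` for every `x`:
the local order-two threading coefficient equals the head term. -/
theorem loc2_eq_headTerm_of_unthreaded {S : Set ℝ} {u : ℝ → E3 → E3} {p : ℝ → E3 → ℝ} {x₀ : E3} {t₀ : ℝ} (hS : IsOpen S)
    (ht₀ : t₀ ∈ S) (hNS : IsClassicalNSSolutionOn S 1 0 u p) (hF : ∀ t ∈ S, ∀ x, threadingFlux u x₀ t x = 0) (x : E3) :
    loc2 (u t₀) x₀ x = inner ℝ (curl (u t₀) x) (gradient (radialVirial (head (u t₀) (p t₀)) x₀) x) := by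
  have h2 := secondJetHeadForm S u p x₀ t₀ hS ht₀ hNS (fun y => hF t₀ ht₀ y) x
  have hzero : iteratedDeriv 2 (fun t => threadingFlux u x₀ t x) t₀ = 0 := by
    have hev : (fun t => threadingFlux u x₀ t x) =ᶠ[𝓝 t₀] fun _ => (0 : ℝ) := by
      filter_upwards [hS.mem_nhds ht₀] with t ht using hF t ht x
    have hd : deriv (fun t => threadingFlux u x₀ t x) =ᶠ[𝓝 t₀] fun _ => (0 : ℝ) := by
      have h := hev.deriv
      simp only [deriv_const'] at h
      exact h
    rw [iteratedDeriv_succ, iteratedDeriv_one, hd.deriv_eq, deriv_const]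
  rw [hzero] at h2
  linarith

end OrderTwoBlowdown

end Summit.NavierStokesRegularity.NavierStokesRegularity.Theorems.PoloidalLiouville.HorizonTower

end
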